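import Mathlib.LinearAlgebra.Dimension.Localization
import Literature.GroupTheory.Index.HerbrandLemma
import Literature.NumberTheory.QuadraticForms.SUnitSquareIndex
import HarnessLib

/-!
# The Herbrand computation behind O'Meara's unit norm index 65:10

Topic `NumberTheory/QuadraticForms`; namespace `Literature.NumberTheory.QuadraticForms.OMeara65`; all
declarations fully proved. The group-theoretic core of O'Meara, *Introduction to quadratic forms*,
§65B Prop. 65:10 (`(𝔲 : N_{E/F} 𝔘) = 2^{b-1}`, the unit norm index of a quadratic extension
`E/F`, from which the first inequality `(J_F : P_F N_{E/F} J_E) ≥ 2` follows), isolated from the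
arithmetic: let `G` be a finitely generated abelian group (in 65:10: the `S`-units `𝔘` of `E`)
with an involution `σ` (the Galois conjugation), and the two endomorphisms of O'Meara's proof

  `N Γ = Γ · σ Γ` (`normEnd σ`),   `T Γ = Γ / σ Γ` (`quotEnd σ`),

so that `N T = T N = 1`, `ker T = G^σ` (in 65:10: `= 𝔲`), `N G = N_{E/F} 𝔘`. Suppose (step 2 of
the book) `U₁ ≤ G^σ` is a subgroup of finite index in `G^σ` without `2`-torsion (in 65:10: the free
part `𝔲₁` of `𝔲 = 𝔲₀ × 𝔲₁`), that the elements of `G` of square `1` are exactly `1, ε` with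
`ε = T Γ₀ ∈ T G` (in 65:10: `ε = -1 = T(√θ)`), and (step 4 of the book, Hilbert 90 plus an
adjustment) `ker N ≤ T G`. Then with `Φ = U₁ · T G` — a subgroup of finite index (step 2:
`G² ⊆ N G · T G ⊆ G^σ · T G`) stable under `N`, `T` — Herbrand's lemma 65:9
(`Literature.GroupTheory.Index.herbrandLemma`) gives, as in step 3 of the book,

* `relIndex_normEnd_mul_two_pow` : `(G^σ : N G) · 2 ^ rk(T G) = 2 ^ rk(U₁)`, and
* `finrank_quotEnd_range_add` : `rk(T G) + rk(U₁) = rk(G)`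

(`rk = Module.finrank ℤ ∘ Additive`), because `Φ_T = U₁ · {1, ε}`, `N Φ = U₁²`, `Φ_N = T G`,
`T Φ = (T G)²`, so `(Φ_T : N Φ) = 2 · 2 ^ rk U₁` and `(Φ_N : T Φ) = 2 · 2 ^ rk (T G)` (O'Meara 65:5,
here `index_sq_eq_two_pow_finrank_mul` from
`Literature.NumberTheory.QuadraticForms.AddSubgroup.index_range_nsmul_eq_pow_mul` of
`SUnitSquareIndex.lean`). In 65:10, `rk G = a + s - 1` and `rk U₁ = s - 1` (Dirichlet), whence
`rk(T G) = a` and `(𝔲 : N 𝔘) = 2^{s-1-a} = 2^{b-1}`; that arithmetic instantiation is carried out in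
the sibling files proving the named fact `unitNormIndex` of `UnitNormIndex.lean`.

## References

* O. T. O'Meara, *Introduction to quadratic forms*, Grundlehren 117, Springer (1963), §65B
  Prop. 65:5, Lemma 65:9, Prop. 65:10 (proof, steps 1–3), PDF pp. 181–185 of the held copy.
-/

noncomputable section

open Module

namespace Literature.NumberTheory.QuadraticForms.OMeara65

/-! ### The endomorphisms `N Γ = Γ σΓ` and `T Γ = Γ / σΓ` of an abelian group with involution -/

section Endos

variable {G : Type*} [CommGroup G] (σ : G ≃* G)

/-- O'Meara's `N : Γ ↦ Γ · σ Γ` (in 65:10, the norm `N_{E/F}` on the `S`-units of `E`).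
[cite: Omeara1963, §65B Prop. 65:10 (proof, step 1)] -/
def normEnd : G →* G where
  toFun g := g * σ g
  map_one' := by rw [map_one, mul_one]
  map_mul' x y := by rw [map_mul, mul_mul_mul_comm]

/-- O'Meara's `T : Γ ↦ Γ / σ Γ` (Hilbert 90: its image is the group of norm-one elements).
[cite: Omeara1963, §65B Prop. 65:10 (proof, step 1)] -/
def quotEnd : G →* G where
  toFun g := g / σ g
  map_one' := by rw [map_one, div_one]
  map_mul' x y := by rw [map_mul, div_mul_div_comm]

/-- `N Γ = Γ · σ Γ` (definitional). [folklore] -/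
@[simp] theorem normEnd_apply (g : G) : normEnd σ g = g * σ g := rfl

/-- `T Γ = Γ / σ Γ` (definitional). [folklore] -/
@[simp] theorem quotEnd_apply (g : G) : quotEnd σ g = g / σ g := rfl

variable {σ} (hσ : ∀ g, σ (σ g) = g)
include hσ

/-- `σ (N Γ) = N Γ`. [folklore] -/
theorem map_normEnd (g : G) : σ (normEnd σ g) = normEnd σ g := by
  rw [normEnd_apply, map_mul, hσ, mul_comm]

/-- `σ (T Γ) = (T Γ)⁻¹`. [folklore] -/
theorem map_quotEnd (g : G) : σ (quotEnd σ g) = (quotEnd σ g)⁻¹ := by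
  rw [quotEnd_apply, map_div, hσ, inv_div]

/-- `N (T Γ) = 1`. [cite: Omeara1963, §65B Prop. 65:10 (proof, step 1)] -/
theorem normEnd_quotEnd (g : G) : normEnd σ (quotEnd σ g) = 1 := by
  rw [normEnd_apply, map_quotEnd hσ, mul_inv_cancel]

/-- `T (N Γ) = 1`. [cite: Omeara1963, §65B Prop. 65:10 (proof, step 1)] -/
theorem quotEnd_normEnd (g : G) : quotEnd σ (normEnd σ g) = 1 := by
  rw [quotEnd_apply, map_normEnd hσ, div_self']

omit hσ in
/-- `Γ ∈ ker T ↔ σ Γ = Γ` (`G_T = G^σ`). [folklore] -/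
theorem mem_ker_quotEnd_iff (g : G) : g ∈ (quotEnd σ).ker ↔ σ g = g := by
  rw [MonoidHom.mem_ker, quotEnd_apply, div_eq_one, eq_comm]

omit hσ in
/-- `Γ ∈ ker N ↔ σ Γ = Γ⁻¹`. [folklore] -/
theorem mem_ker_normEnd_iff (g : G) : g ∈ (normEnd σ).ker ↔ σ g = g⁻¹ := by
  rw [MonoidHom.mem_ker, normEnd_apply, mul_eq_one_iff_eq_inv']

omit hσ in
/-- On `σ`-fixed elements `N` is squaring: `N u = u²`. [folklore] -/
theorem normEnd_of_fixed {u : G} (hu : σ u = u) : normEnd σ u = u ^ 2 := by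
  rw [normEnd_apply, hu, sq]

omit hσ in
/-- On `σ`-fixed elements `T` is trivial. [folklore] -/
theorem quotEnd_of_fixed {u : G} (hu : σ u = u) : quotEnd σ u = 1 := by
  rw [quotEnd_apply, hu, div_self']

/-- On `T G`, `T` is squaring: `T t = t²` (as `σ t = t⁻¹`). [folklore] -/
theorem quotEnd_of_mem_range {t : G} (ht : t ∈ (quotEnd σ).range) : quotEnd σ t = t ^ 2 := by
  obtain ⟨g, rfl⟩ := ht
  rw [quotEnd_apply σ (quotEnd σ g), map_quotEnd hσ, div_inv_eq_mul, sq]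

/-- On `T G`, `N` is trivial. [folklore] -/
theorem normEnd_of_mem_range {t : G} (ht : t ∈ (quotEnd σ).range) : normEnd σ t = 1 := by
  obtain ⟨g, rfl⟩ := ht
  exact normEnd_quotEnd hσ g

/-- `N G ≤ ker T`. [folklore] -/
theorem range_normEnd_le_ker : (normEnd σ).range ≤ (quotEnd σ).ker := by
  rintro _ ⟨g, rfl⟩
  exact quotEnd_normEnd hσ g

/-- `T G ≤ ker N`. [folklore] -/
theorem range_quotEnd_le_ker : (quotEnd σ).range ≤ (normEnd σ).ker := by
  rintro _ ⟨g, rfl⟩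
  exact normEnd_quotEnd hσ g

omit hσ in
/-- `Γ² = N Γ · T Γ`, so `G² ≤ G^σ · T G`. [cite: Omeara1963, §65B Prop. 65:10 (proof, step 2)] -/
theorem sq_eq_normEnd_mul_quotEnd (g : G) : g ^ 2 = normEnd σ g * quotEnd σ g := by
  rw [normEnd_apply, quotEnd_apply, sq, div_eq_mul_inv, mul_mul_mul_comm, mul_inv_cancel, mul_one]

end Endos

/-! ### Index of the squares in a finitely generated abelian group (O'Meara 65:5, abstract) -/

section Squares

variable {G : Type*} [CommGroup G]

/-- Powers in a subgroup: `(u.map (x ↦ xⁿ)).relIndex u` is the index of the `n`-th powers of the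
group `↥u`. [folklore] -/
theorem relIndex_map_powMonoidHom (u : Subgroup G) (n : ℕ) :
    (u.map (powMonoidHom n)).relIndex u = ((powMonoidHom n : u →* u).range).index := by
  rw [Subgroup.relIndex]
  congr 1
  ext x
  simp only [Subgroup.mem_subgroupOf, Subgroup.mem_map, MonoidHom.mem_range, powMonoidHom_apply]
  constructor
  · rintro ⟨y, hy, hyx⟩
    exact ⟨⟨y, hy⟩, Subtype.ext (by simpa using hyx)⟩
  · rintro ⟨y, rfl⟩
    exact ⟨y, y.2, by simp⟩

/-- **O'Meara 65:5, abstract form**: in a finitely generated abelian group `H` the squares have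
index `(H : H²) = 2 ^ rk(H) · #{h | h² = 1}` (`rk = finrank ℤ ∘ Additive`): the free quotient
contributes `2 ^ rk` and the finite torsion subgroup `H₀` contributes `(H₀ : H₀²) = #H₀[2] = #H[2]`
(`Literature.NumberTheory.QuadraticForms.AddSubgroup.index_range_nsmul_eq_pow_mul`).
[cite: Omeara1963, §65B Prop. 65:5] -/
theorem index_range_sq_eq (H : Type*) [CommGroup H] [Module.Finite ℤ (Additive H)] :
    (powMonoidHom 2 : H →* H).range.index =
      2 ^ finrank ℤ (Additive H) * Nat.card (powMonoidHom 2 : H →* H).ker := by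
  have h1 : (powMonoidHom 2 : H →* H).range.index =
      (nsmulAddMonoidHom (α := Additive H) 2).range.index := rfl
  rw [h1, AddSubgroup.index_range_nsmul_eq_pow_mul two_ne_zero]
  congr 1
  haveI : Finite (AddCommGroup.torsion (Additive H)) :=
    AddSubgroup.finite_torsion_of_moduleFinite (Additive H)
  rw [_root_.AddSubgroup.index_range]
  -- the `2`-torsion of the torsion subgroup is the `2`-torsion of `H`
  refine Nat.card_eq_of_bijective (fun x ↦ ⟨Additive.toMul x.1.1, ?_⟩) ⟨?_, ?_⟩
  · have hx := x.2
    rw [AddMonoidHom.mem_ker, nsmulAddMonoidHom_apply] at hx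
    rw [MonoidHom.mem_ker, powMonoidHom_apply]
    exact congrArg (fun z : AddCommGroup.torsion (Additive H) ↦ Additive.toMul (z : Additive H)) hx
  · rintro ⟨⟨x, _⟩, _⟩ ⟨⟨y, _⟩, _⟩ h
    simp only [Subtype.mk.injEq] at h
    subst h; rfl
  · rintro ⟨x, hx⟩
    rw [MonoidHom.mem_ker, powMonoidHom_apply] at hx
    have hx' : (2 : ℕ) • Additive.ofMul x = 0 := congrArg Additive.ofMul hx
    have hxT : Additive.ofMul x ∈ AddCommGroup.torsion (Additive H) := by
      rw [AddCommGroup.mem_torsion, isOfFinAddOrder_iff_nsmul_eq_zero]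
      exact ⟨2, two_pos, hx'⟩
    refine ⟨⟨⟨Additive.ofMul x, hxT⟩, ?_⟩, rfl⟩
    rw [AddMonoidHom.mem_ker, nsmulAddMonoidHom_apply]
    exact Subtype.ext hx'

end Squares

/-! ### Ranks of subgroups: `rk(U ⊔ V) = rk U + rk V` for `U ⊓ V = ⊥`, and finite index -/

section Ranks

variable {G : Type*} [CommGroup G]

/-- The `ℤ`-submodule of `Additive G` attached to a subgroup `H ≤ G`. [folklore] -/
def toIntSubmodule' (H : Subgroup G) : Submodule ℤ (Additive G) :=
  AddSubgroup.toIntSubmodule (Subgroup.toAddSubgroup H)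

/-- Membership in `toIntSubmodule' H` (definitional). [folklore] -/
@[simp] theorem mem_toIntSubmodule'_iff (H : Subgroup G) (x : Additive G) :
    x ∈ toIntSubmodule' H ↔ Additive.toMul x ∈ H := Iff.rfl

/-- `Additive ↥H ≃ₗ[ℤ] toIntSubmodule' H` (the identity on underlying elements). [folklore] -/
def additiveLinearEquiv (H : Subgroup G) : Additive H ≃ₗ[ℤ] toIntSubmodule' H :=
  AddEquiv.toIntLinearEquiv
    { toFun := fun x ↦ ⟨Additive.ofMul ((Additive.toMul x : H) : G), (Additive.toMul x).2⟩
      invFun := fun y ↦ Additive.ofMul ⟨Additive.toMul (y : Additive G), y.2⟩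
      left_inv := fun _ ↦ rfl
      right_inv := fun _ ↦ rfl
      map_add' := fun _ _ ↦ rfl }

/-- `rk H = finrank ℤ (toIntSubmodule' H)`. [folklore] -/
theorem finrank_additive_eq (H : Subgroup G) :
    finrank ℤ (Additive H) = finrank ℤ (toIntSubmodule' H) :=
  (additiveLinearEquiv H).finrank_eq

/-- A subgroup of a finitely generated abelian group is finitely generated (as a `ℤ`-module).
[folklore] -/
theorem moduleFinite_additive [Module.Finite ℤ (Additive G)] (H : Subgroup G) :
    Module.Finite ℤ (Additive H) :=
  Module.Finite.equiv (additiveLinearEquiv H).symm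

/-- `toIntSubmodule'` preserves `⊔`. [folklore] -/
theorem toIntSubmodule'_sup (U V : Subgroup G) :
    toIntSubmodule' (U ⊔ V) = toIntSubmodule' U ⊔ toIntSubmodule' V := by
  simp only [toIntSubmodule', OrderIso.map_sup]

/-- `finrank ℤ (A × B) = finrank ℤ A + finrank ℤ B` for finitely generated abelian groups (rank–nullity
over the domain `ℤ`; Mathlib's `Module.finrank_prod` assumes free modules). [folklore] -/
theorem finrank_prod_int (A B : Type*) [AddCommGroup A] [AddCommGroup B] [Module.Finite ℤ A]
    [Module.Finite ℤ B] : finrank ℤ (A × B) = finrank ℤ A + finrank ℤ B := by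
  have h := Submodule.finrank_quotient_add_finrank (LinearMap.ker (LinearMap.fst ℤ A B))
  rw [(LinearMap.quotKerEquivOfSurjective (LinearMap.fst ℤ A B) Prod.fst_surjective).finrank_eq,
    LinearMap.ker_fst, ← (LinearEquiv.ofInjective (LinearMap.inr ℤ A B) LinearMap.inr_injective).finrank_eq]
    at h
  exact h.symm

/-- **`rk(U ⊔ V) = rk U + rk V` when `U ⊓ V = ⊥`** (the sum is direct: `U × V ≅ U ⊔ V`), for
subgroups of a finitely generated abelian group. [folklore] -/
theorem finrank_sup_of_disjoint [Module.Finite ℤ (Additive G)] (U V : Subgroup G) (hUV : U ⊓ V = ⊥) :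
    finrank ℤ (Additive ↥(U ⊔ V)) = finrank ℤ (Additive U) + finrank ℤ (Additive V) := by
  rw [finrank_additive_eq, finrank_additive_eq, finrank_additive_eq, toIntSubmodule'_sup,
    ← finrank_prod_int]
  set A := toIntSubmodule' U
  set B := toIntSubmodule' V
  have hAB : A ⊓ B = ⊥ := by
    rw [show A ⊓ B = toIntSubmodule' (U ⊓ V) by simp only [A, B, toIntSubmodule', OrderIso.map_inf],
      hUV]
    simp [toIntSubmodule']
  let f : (A × B) →ₗ[ℤ] ↥(A ⊔ B) :=
    (LinearMap.coprod A.subtype B.subtype).codRestrict (A ⊔ B) (by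
      rintro ⟨a, b⟩
      rw [LinearMap.coprod_apply]
      exact Submodule.add_mem_sup a.2 b.2)
  refine (LinearEquiv.ofBijective f ⟨?_, ?_⟩).finrank_eq.symm
  · rintro ⟨a, b⟩ ⟨a', b'⟩ h
    have h' : (a : Additive G) + b = a' + b' := congrArg Subtype.val h
    have hmem : (a : Additive G) - a' ∈ A ⊓ B := by
      refine ⟨A.sub_mem a.2 a'.2, ?_⟩
      have : (a : Additive G) - a' = b' - b := by
        rw [sub_eq_sub_iff_add_eq_add, h', add_comm]
      rw [this]
      exact B.sub_mem b'.2 b.2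
    rw [hAB, Submodule.mem_bot, sub_eq_zero] at hmem
    have ha : a = a' := Subtype.ext hmem
    subst ha
    have hb : (b : Additive G) = b' := add_left_cancel h'
    rw [Subtype.ext hb]
  · rintro ⟨x, hx⟩
    obtain ⟨a, ha, b, hb, rfl⟩ := Submodule.mem_sup.1 hx
    exact ⟨(⟨a, ha⟩, ⟨b, hb⟩), rfl⟩

/-- A subgroup of finite index of a finitely generated abelian group has the same rank
(`x ↦ (G : H) • x` maps `G` into `H` with torsion kernel). [folklore] -/
theorem finrank_eq_of_index_ne_zero [Module.Finite ℤ (Additive G)] (H : Subgroup G) (hH : H.index ≠ 0) :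
    finrank ℤ (Additive H) = finrank ℤ (Additive G) := by
  rw [finrank_additive_eq]
  apply le_antisymm (Submodule.finrank_le _)
  set k : ℤ := (H.index : ℤ) with hk
  have hk0 : k ≠ 0 := Int.natCast_ne_zero.2 hH
  have hmem : ∀ x : Additive G, k • x ∈ toIntSubmodule' H := fun x ↦ by
    rw [mem_toIntSubmodule'_iff, hk]
    simpa using H.pow_index_mem (Additive.toMul x)
  let f : Additive G →ₗ[ℤ] toIntSubmodule' H :=
    (k • (LinearMap.id : Additive G →ₗ[ℤ] Additive G)).codRestrict (toIntSubmodule' H) fun x ↦ hmem x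
  have hker : Module.rank ℤ (LinearMap.ker f) = 0 := by
    rw [rank_eq_zero_iff]
    rintro ⟨x, hx⟩
    refine ⟨k, hk0, Subtype.ext ?_⟩
    rw [LinearMap.mem_ker] at hx
    have := congrArg Subtype.val hx
    simpa [f] using this
  have h := LinearMap.rank_range_add_rank_ker f
  rw [hker, add_zero] at h
  have hle : Module.rank ℤ (Additive G) ≤ Module.rank ℤ (toIntSubmodule' H) := by
    rw [← h]
    exact Submodule.rank_le _
  exact Module.finrank_le_finrank_of_rank_le_rank (by simpa using hle) (Module.rank_lt_aleph0 ℤ _)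

end Ranks

/-! ### The Herbrand computation -/

section Main

variable {G : Type*} [CommGroup G] {σ : G ≃* G}

/-- Two endomorphisms agreeing on a subgroup have the same image of it. [folklore] -/
theorem map_eq_map_of_eqOn {f g : G →* G} {H : Subgroup G} (h : ∀ x ∈ H, f x = g x) :
    H.map f = H.map g := by
  ext y
  simp only [Subgroup.mem_map]
  constructor
  · rintro ⟨x, hx, rfl⟩
    exact ⟨x, hx, (h x hx).symm⟩
  · rintro ⟨x, hx, rfl⟩
    exact ⟨x, hx, h x hx⟩

variable (hσ : ∀ g, σ (σ g) = g) {ε : G} (hε : ε ≠ 1) (hεT : ε ∈ (quotEnd σ).range)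
  (h2 : ∀ g : G, g ^ 2 = 1 ↔ g = 1 ∨ g = ε)
  {U₁ : Subgroup G} (hU₁ : ∀ u ∈ U₁, σ u = u) (hfin : U₁.relIndex (quotEnd σ).ker ≠ 0)
  (htf : ∀ u ∈ U₁, u ^ 2 = 1 → u = 1)

include h2 in
/-- `ε² = 1`. [folklore] -/
theorem sq_eps_eq_one : ε ^ 2 = 1 := (h2 ε).2 (Or.inr rfl)

include hU₁ in
/-- `N Φ = U₁²` for `Φ = U₁ ⊔ T G`. [cite: Omeara1963, §65B Prop. 65:10 (proof, step 3)] -/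
theorem map_normEnd_sup (hσ : ∀ g, σ (σ g) = g) :
    (U₁ ⊔ (quotEnd σ).range).map (normEnd σ) = U₁.map (powMonoidHom 2) := by
  rw [Subgroup.map_sup, map_eq_map_of_eqOn (g := powMonoidHom 2)
      (fun u hu ↦ by rw [powMonoidHom_apply]; exact normEnd_of_fixed (hU₁ u hu)),
    (Subgroup.map_eq_bot_iff _).2 (range_quotEnd_le_ker hσ), sup_bot_eq]

include hU₁ in
/-- `T Φ = (T G)²` for `Φ = U₁ ⊔ T G`. [cite: Omeara1963, §65B Prop. 65:10 (proof, step 3)] -/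
theorem map_quotEnd_sup (hσ : ∀ g, σ (σ g) = g) :
    (U₁ ⊔ (quotEnd σ).range).map (quotEnd σ) = (quotEnd σ).range.map (powMonoidHom 2) := by
  rw [Subgroup.map_sup, (Subgroup.map_eq_bot_iff _).2 (fun u hu ↦ quotEnd_of_fixed (hU₁ u hu)),
    bot_sup_eq]
  exact map_eq_map_of_eqOn fun t ht ↦ by rw [powMonoidHom_apply]; exact quotEnd_of_mem_range hσ ht

include hU₁ htf in
/-- `Φ_N = Φ ⊓ ker N = T G` for `Φ = U₁ ⊔ T G` (`N (u t) = u² = 1` forces `u = 1`).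
[cite: Omeara1963, §65B Prop. 65:10 (proof, step 3)] -/
theorem sup_inf_ker_normEnd (hσ : ∀ g, σ (σ g) = g) :
    (U₁ ⊔ (quotEnd σ).range) ⊓ (normEnd σ).ker = (quotEnd σ).range := by
  apply le_antisymm
  · intro x hx'
    obtain ⟨hx, hxN⟩ := Subgroup.mem_inf.1 hx'
    obtain ⟨u, hu, t, ht, rfl⟩ := Subgroup.mem_sup.1 hx
    have hu1 : u = 1 := htf u hu (by
      rw [MonoidHom.mem_ker, map_mul, normEnd_of_mem_range hσ ht, mul_one,
        normEnd_of_fixed (hU₁ u hu)] at hxN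
      exact hxN)
    rw [hu1, one_mul]
    exact ht
  · exact le_inf le_sup_right (range_quotEnd_le_ker hσ)

include hU₁ h2 in
/-- `Φ_T = Φ ⊓ ker T = U₁ · {1, ε}` for `Φ = U₁ ⊔ T G` (`T (u t) = t² = 1` forces `t = 1` or `ε`).
[cite: Omeara1963, §65B Prop. 65:10 (proof, step 3)] -/
theorem sup_inf_ker_quotEnd (hσ : ∀ g, σ (σ g) = g) (hεT : ε ∈ (quotEnd σ).range) :
    (U₁ ⊔ (quotEnd σ).range) ⊓ (quotEnd σ).ker = U₁ ⊔ Subgroup.zpowers ε := by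
  apply le_antisymm
  · intro x hx'
    obtain ⟨hx, hxT⟩ := Subgroup.mem_inf.1 hx'
    obtain ⟨u, hu, t, ht, rfl⟩ := Subgroup.mem_sup.1 hx
    have ht2 : t ^ 2 = 1 := by
      rw [MonoidHom.mem_ker, map_mul, quotEnd_of_fixed (hU₁ u hu), one_mul,
        quotEnd_of_mem_range hσ ht] at hxT
      exact hxT
    rcases (h2 t).1 ht2 with rfl | rfl
    · rw [mul_one]; exact Subgroup.mem_sup_left hu
    · exact Subgroup.mul_mem_sup hu (Subgroup.mem_zpowers _)
  · refine sup_le (le_inf le_sup_left fun u hu ↦ quotEnd_of_fixed (hU₁ u hu)) ?_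
    rw [Subgroup.zpowers_le]
    refine Subgroup.mem_inf.2 ⟨Subgroup.mem_sup_right hεT, MonoidHom.mem_ker.2 ?_⟩
    rw [quotEnd_of_mem_range hσ hεT]
    exact (h2 ε).2 (Or.inr rfl)

include hε h2 in
/-- `{1, ε}` has two elements: `Nat.card (zpowers ε) = 2`. [folklore] -/
theorem natCard_zpowers_eps : Nat.card (Subgroup.zpowers ε) = 2 := by
  rw [Nat.card_zpowers]
  exact orderOf_eq_prime ((h2 ε).2 (Or.inr rfl)) hε

include hε h2 htf in
/-- `(U₁ · {1, ε} : U₁) = 2` (as `ε ∉ U₁`). [folklore] -/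
theorem relIndex_sup_zpowers_eps : U₁.relIndex (U₁ ⊔ Subgroup.zpowers ε) = 2 := by
  have hεU : ε ∉ U₁ := fun h ↦ hε (htf ε h ((h2 ε).2 (Or.inr rfl)))
  rw [sup_comm, Subgroup.relIndex_sup_right, Subgroup.relIndex,
    show U₁.subgroupOf (Subgroup.zpowers ε) = ⊥ from ?_, Subgroup.index_bot,
    natCard_zpowers_eps hε h2]
  rw [eq_bot_iff]
  rintro ⟨x, hx⟩ hxU
  rw [Subgroup.mem_subgroupOf] at hxU
  rw [Subgroup.mem_bot, Subgroup.mk_eq_one]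
  obtain ⟨k, rfl⟩ := Subgroup.mem_zpowers_iff.1 hx
  -- `ε ^ k` is `1` or `ε`
  have h1 : (ε ^ k) ^ 2 = 1 := by
    rw [← zpow_natCast, ← zpow_mul, mul_comm, zpow_mul, zpow_natCast, (h2 ε).2 (Or.inr rfl),
      one_zpow]
  rcases (h2 _).1 h1 with h | h
  · exact h
  · exact absurd (h ▸ hxU) hεU

include htf in
/-- `(U₁ : U₁²) = 2 ^ rk U₁` (65:5 for the torsion-free `U₁`). [cite: Omeara1963, §65B Prop. 65:5] -/
theorem relIndex_sq_U₁ [Module.Finite ℤ (Additive U₁)] :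
    (U₁.map (powMonoidHom 2)).relIndex U₁ = 2 ^ finrank ℤ (Additive U₁) := by
  rw [relIndex_map_powMonoidHom, index_range_sq_eq]
  have : Nat.card (powMonoidHom 2 : U₁ →* U₁).ker = 1 := by
    rw [Nat.card_eq_one_iff_exists]
    refine ⟨1, fun x ↦ ?_⟩
    have hx := x.2
    rw [MonoidHom.mem_ker, powMonoidHom_apply] at hx
    have hx' : ((x.1 : U₁) : G) ^ 2 = 1 := by simpa using congrArg Subtype.val hx
    apply Subtype.ext
    apply Subtype.ext
    simpa using htf _ x.1.2 hx'
  rw [this, mul_one]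

include hε hεT h2 in
/-- `(T G : (T G)²) = 2 · 2 ^ rk(T G)` (65:5; the elements of square `1` in `T G` are `1, ε`).
[cite: Omeara1963, §65B Prop. 65:5] -/
theorem relIndex_sq_range [Module.Finite ℤ (Additive (quotEnd σ).range)] :
    ((quotEnd σ).range.map (powMonoidHom 2)).relIndex (quotEnd σ).range =
      2 ^ finrank ℤ (Additive (quotEnd σ).range) * 2 := by
  rw [relIndex_map_powMonoidHom, index_range_sq_eq]
  congr 1
  refine (Nat.card_eq_of_bijective (fun x ↦ (⟨(x.1 : G), ?_⟩ : Subgroup.zpowers ε)) ⟨?_, ?_⟩).trans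
    (natCard_zpowers_eps hε h2)
  · have hx := x.2
    rw [MonoidHom.mem_ker, powMonoidHom_apply] at hx
    have hx' : (x.1 : G) ^ 2 = 1 := by simpa using congrArg Subtype.val hx
    rcases (h2 _).1 hx' with h | h
    · rw [h]; exact Subgroup.one_mem _
    · rw [h]; exact Subgroup.mem_zpowers _
  · rintro ⟨⟨x, _⟩, _⟩ ⟨⟨y, _⟩, _⟩ h
    simp only [Subtype.mk.injEq] at h
    subst h; rfl
  · rintro ⟨y, hy⟩
    obtain ⟨k, rfl⟩ := Subgroup.mem_zpowers_iff.1 hy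
    have h1 : (ε ^ k) ^ 2 = 1 := by
      rw [← zpow_natCast, ← zpow_mul, mul_comm, zpow_mul, zpow_natCast, (h2 ε).2 (Or.inr rfl),
        one_zpow]
    have hmem : ε ^ k ∈ (quotEnd σ).range := Subgroup.zpow_mem _ hεT k
    refine ⟨⟨⟨ε ^ k, hmem⟩, ?_⟩, rfl⟩
    rw [MonoidHom.mem_ker, powMonoidHom_apply]
    exact Subtype.ext (by simpa using h1)

include hσ in
/-- Step 2: `Γ ^ (2k) ∈ Φ = U₁ ⊔ T G` for every `Γ`, where `k = (G^σ : U₁)`: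
`Γ² = N Γ · T Γ` with `N Γ ∈ G^σ` and `(N Γ)^k ∈ U₁`. [cite: Omeara1963, §65B Prop. 65:10 (proof, step 2)] -/
theorem pow_mem_sup (g : G) :
    g ^ (2 * U₁.relIndex (quotEnd σ).ker) ∈ U₁ ⊔ (quotEnd σ).range := by
  rw [pow_mul, sq_eq_normEnd_mul_quotEnd, mul_pow]
  refine Subgroup.mul_mem_sup ?_ (Subgroup.pow_mem _ (MonoidHom.mem_range.2 ⟨g, rfl⟩) _)
  have hmem : (⟨normEnd σ g, quotEnd_normEnd hσ g⟩ : ↥(quotEnd σ).ker) ^ U₁.relIndex (quotEnd σ).ker ∈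
      U₁.subgroupOf (quotEnd σ).ker :=
    Subgroup.pow_index_mem (U₁.subgroupOf (quotEnd σ).ker) _
  rw [Subgroup.mem_subgroupOf] at hmem
  exact hmem

include hσ hfin in
/-- Step 2: `Φ = U₁ ⊔ T G` has finite index in `G` (`G/Φ` is finitely generated of exponent
dividing `2k`). [cite: Omeara1963, §65B Prop. 65:10 (proof, step 2)] -/
theorem index_sup_ne_zero [Module.Finite ℤ (Additive G)] : (U₁ ⊔ (quotEnd σ).range).index ≠ 0 := by
  haveI : Group.FG G := by
    rw [GroupFG.iff_add_fg, ← Module.Finite.iff_addGroup_fg]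
    infer_instance
  haveI : Group.FG (G ⧸ (U₁ ⊔ (quotEnd σ).range)) := Group.fg_of_surjective (QuotientGroup.mk'_surjective _)
  haveI : Finite (G ⧸ (U₁ ⊔ (quotEnd σ).range)) := by
    refine CommGroup.finite_of_fg_torsion _ fun x ↦ ?_
    obtain ⟨g, rfl⟩ := QuotientGroup.mk_surjective x
    rw [isOfFinOrder_iff_pow_eq_one]
    refine ⟨2 * U₁.relIndex (quotEnd σ).ker, by omega, ?_⟩
    rw [← QuotientGroup.mk_pow, QuotientGroup.eq_one_iff]
    exact pow_mem_sup hσ g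
  exact Subgroup.index_ne_zero_of_finite

include hσ hfin in
/-- Step 3: `rk Φ = rk G`. [cite: Omeara1963, §65B Prop. 65:10 (proof, step 3)] -/
theorem finrank_sup_eq [Module.Finite ℤ (Additive G)] :
    finrank ℤ (Additive ↥(U₁ ⊔ (quotEnd σ).range)) = finrank ℤ (Additive G) :=
  finrank_eq_of_index_ne_zero _ (index_sup_ne_zero hσ hfin)

include hU₁ htf hσ in
/-- `U₁ ⊓ T G = ⊥` (an element of both is `σ`-fixed with `T x = x²`, so `x² = 1`, `x = 1`).
[cite: Omeara1963, §65B Prop. 65:10 (proof, step 2: "`𝔲₁ ∩ T 𝔘 = 1`")] -/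
theorem inf_range_eq_bot : U₁ ⊓ (quotEnd σ).range = ⊥ := by
  rw [eq_bot_iff]
  rintro x ⟨hxU, hxT⟩
  rw [Subgroup.mem_bot]
  refine htf x hxU ?_
  rw [← quotEnd_of_mem_range hσ hxT]
  exact quotEnd_of_fixed (hU₁ x hxU)

include hσ hε hεT h2 hU₁ hfin htf in
/-- **The Herbrand computation of O'Meara 65:10 (steps 1–3), abstract form.** Let `G` be a
finitely generated abelian group with an involution `σ`, `N Γ = Γ σΓ`, `T Γ = Γ/σΓ`; let
`U₁ ≤ G^σ = ker T` have finite index in `G^σ` and no element of order `2`; suppose the elements of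
`G` of square `1` are `1` and `ε = T Γ₀ ≠ 1`, and (step 4) `ker N ≤ T G`. Then
`(G^σ : N G) · 2 ^ rk(T G) = 2 ^ rk(U₁)`. Proof: Herbrand's lemma
(`Literature.GroupTheory.Index.herbrandLemma`) for `Φ = U₁ · T G`:
`(G_T : N G)(Φ_N : T Φ) = (G_N : T G)(Φ_T : N Φ)` with `(G_N : T G) = 1`,
`(Φ_N : T Φ) = (T G : (T G)²) = 2 · 2 ^ rk(T G)` and `(Φ_T : N Φ) = (U₁ · {1, ε} : U₁²) = 2 · 2 ^ rk U₁`.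
[cite: Omeara1963, §65B Prop. 65:10 (proof, steps 1–3)] -/
theorem relIndex_normEnd_mul_two_pow [Module.Finite ℤ (Additive G)]
    (h4 : (normEnd σ).ker ≤ (quotEnd σ).range) :
    (normEnd σ).range.relIndex (quotEnd σ).ker * 2 ^ finrank ℤ (Additive (quotEnd σ).range) =
      2 ^ finrank ℤ (Additive U₁) := by
  haveI := moduleFinite_additive (quotEnd σ).range
  haveI := moduleFinite_additive U₁
  set N := normEnd σ with hN
  set T := quotEnd σ with hT
  set Φ := U₁ ⊔ T.range with hΦ
  -- the two indices of Herbrand's lemma for `Φ`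
  have hΦT : (Φ.map T).relIndex (Φ ⊓ N.ker) = 2 ^ finrank ℤ (Additive T.range) * 2 := by
    rw [hΦ, map_quotEnd_sup hU₁ hσ, sup_inf_ker_normEnd hU₁ htf hσ]
    exact relIndex_sq_range hε hεT h2
  have hΦN : (Φ.map N).relIndex (Φ ⊓ T.ker) = 2 ^ finrank ℤ (Additive U₁) * 2 := by
    rw [hΦ, map_normEnd_sup hU₁ hσ, sup_inf_ker_quotEnd h2 hU₁ hσ hεT,
      ← Subgroup.relIndex_mul_relIndex (U₁.map (powMonoidHom 2)) U₁ (U₁ ⊔ Subgroup.zpowers ε)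
        (fun _ ⟨u, hu, h⟩ ↦ h ▸ U₁.pow_mem hu 2) le_sup_left,
      relIndex_sq_U₁ htf, relIndex_sup_zpowers_eps hε h2 htf]
  have hH := Literature.GroupTheory.Index.herbrandLemma N T (normEnd_quotEnd hσ) (quotEnd_normEnd hσ) Φ
    (index_sup_ne_zero hσ hfin)
    (by
      rw [hΦ, map_normEnd_sup hU₁ hσ]
      rintro _ ⟨u, hu, rfl⟩
      exact Subgroup.mem_sup_left (U₁.pow_mem hu 2))
    (by
      rw [hΦ, map_quotEnd_sup hU₁ hσ]
      rintro _ ⟨t, ht, rfl⟩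
      exact Subgroup.mem_sup_right (T.range.pow_mem ht 2))
    (by rw [hΦN]; positivity) (by rw [hΦT]; positivity)
  obtain ⟨h, -, -⟩ := hH
  rw [hΦT, hΦN, Subgroup.relIndex_eq_one.2 h4, one_mul] at h
  -- `r · (2^t · 2) = 2^u · 2`
  have h' : ((normEnd σ).range.relIndex (quotEnd σ).ker * 2 ^ finrank ℤ (Additive T.range)) * 2 =
      2 ^ finrank ℤ (Additive U₁) * 2 := by rw [← h]; ring
  exact Nat.eq_of_mul_eq_mul_right two_pos h'

include hσ hU₁ hfin htf in
/-- **Ranks in O'Meara 65:10 (step 3):** `rk(T G) + rk(U₁) = rk(G)` — `Φ = U₁ · T G` is a direct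
product (`U₁ ∩ T G = 1`) of finite index in `G`. In 65:10: `rank 𝔘 = a + s - 1`,
`rank 𝔲₁ = s - 1`, hence `rank T 𝔘 = a`. [cite: Omeara1963, §65B Prop. 65:10 (proof, step 3)] -/
theorem finrank_quotEnd_range_add [Module.Finite ℤ (Additive G)] :
    finrank ℤ (Additive (quotEnd σ).range) + finrank ℤ (Additive U₁) = finrank ℤ (Additive G) := by
  rw [← finrank_sup_eq hσ hfin (U₁ := U₁), finrank_sup_of_disjoint U₁ _ (inf_range_eq_bot hσ hU₁ htf),
    add_comm]

end Main

end Literature.NumberTheory.QuadraticForms.OMeara65
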